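import Literature.NumberTheory.EllipticCurves.BertoliniLongoVenerucci2026.DefiniteGrossPeriodSelmer
import Literature.NumberTheory.EllipticCurves.BSDQuadraticDescentShaOddPartProofs
import Summits.BirchSwinnertonDyer.Rank1Residual.X9.ChaDescentRecords
import HarnessLib

/-!
# Class X9, `p = 5`, RANK 0: the DEFINITE anticyclotomic route — `BSD(E,5)` from Bertolini–Longo–Venerucci 2026 (Thm. B at `χ = 𝟙`) and an exact Gross-point certificate

HONEST FRAMING (cell `b2b-bsdres-*`, verbatim): the cell deletes COMBINATION-SHAPED residual classes of
the rank-≤1 BSD formula from PUBLISHED theorems only and TYPES the construction-shaped remainder; this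
is not "finishing BSD". Class X9 (good ordinary `p ≥ 5`, `ρ̄_{E,p}` irreducible and not surjective) stays
TYPED at class level; everything here is PER PAIR; no lane verdict is changed; nothing is booked by this
unit (the lane books, the referee rules). Unit `b2b-bsdres-x9`, gen 24 (census
`HOME/b2b-bsdres-x9/X9-DEFINITE-G24.md`).

## What this file does (our own work, hence `Summits/`)

After gen 20 the X9 row was TERMINAL with 22 flagged-only pairs `(E, 5)` (`N < 5·10⁵`, `r_an ≤ 1`, image
`5S4`), each with ONE multiplicative prime `ℓ` carrying `5 ∣ c_ℓ` — the prime that inflates every Heegner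
index (Cha / Jetchev), is exactly where `ρ̄` is unramified (no Skinner–Urban (ram) prime), and makes
hypothesis (im) of Burungale–Castella–Skinner 2025 unsatisfiable (`not_bcsHypothesisIm_of_classX9`).
The lineage never priced the DEFINITE anticyclotomic setting: `N = ℓ·M²` with `M` additive, so for an
imaginary quadratic `K` with `ℓ` INERT and the primes of `M` split, `(N⁺, N⁻) = (M², ℓ)` is exactly the
shape of Hypothesis 1.1 of Bertolini–Longo–Venerucci, *The anticyclotomic main conjectures for elliptic
curves*, Math. Ann. 2026 [BertoliniLongoVenerucci2026] (bullet 5 "`q ∣ N⁺ ⇒ H⁰(I_q, E[p]) = 0`" forces `N⁺`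
to be additive; bullet 6 is vacuous for `ℓ ∈ {2,3} ≢ ±1 (mod 5)`; the image hypothesis is IRREDUCIBLE,
not surjective). Their Theorem B at the trivial character (tree fact
`BLV2026_card_selmerGroupPInfty_eq_pow_of_grossPeriod`, `Literature/…/BertoliniLongoVenerucci2026/`, with
its READING FLAGS RF1–RF3) reads `#Sel_{5^∞}(E/K) = 5^{2·ord₅ ψ_f(P_K)}`, where `ψ_f(P_K) ∈ ℤ` — the value
of the primitive integral `f`-eigenfunctional of the Brandt module of `(N⁺, N⁻)` on the Gross divisor of
`K` — is an EXACT FINITE COMPUTATION. Hence (this file):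

* `noPTorsion_of_selmerGroupPInfty_baseChange_eq_bot` — `Sel_{p^∞}(E/K) = 0` for a quadratic `K` and an
  odd `p` gives `Ш(E/ℚ)[p] = 0` (PROVED: `Sel_{p^∞}(E/K) ↠ Ш(E/K)[p^∞]`, tree
  `map_primaryH1ToH1_selmerGroupPInfty`; restriction is injective on `Ш(E/ℚ)[p]`, tree
  `injOn_shaRestriction_torsionBy`).
* `bsdp_of_BLV2026_of_grossPeriod_unit` — the GENERIC consumer: the fact + `5 ∤ ψ_f(P_K)` + analytic
  rank `≤ 1` + `ord₅ #Ш_an = 0` ⟹ `BSD(E,5)` (Miller), via `Typed.bsdp_of_shaAn_unit_of_noPTorsion` (GZK).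
* `bsdp_of_ainvs_of_BLV2026_of_grossPeriod_unit` — the same with every curve-side hypothesis of the fact
  DECIDED from the integer model (`5 ∤ Δ`: good at `5`; the kernel point count `#Ẽ(𝔽₅) = n₅`: ordinary and
  `a₅ ≢ ±1`; a Frobenius witness `ℓ₀` for the irreducibility of `E[5]`, Mazur 1978 Prop. 6.3 (1)).
* the RECORDS (`bsdp_t216482e1_of_BLV2026`, `bsdp_t216482g1_of_BLV2026`, `bsdp_t155682e1_of_BLV2026`; FINISH.md
  §2 rows 12, 13, 9 — row 13 was the `650 … 15 000` core-h "deep hunt" target) are in the sibling file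
  `X9/DefiniteGrossPeriodRecordsA.lean`, which instantiates `bsdp_of_ainvs_of_BLV2026_of_grossPeriod_unit`.

What stays a BINDER in each record (displayed, discharged outside the kernel — the lineage's standard,
cf. `hcong` / `hcertA` / the Heegner-index certificates): `hGZK`, `hBLV` (published); `r_an(E) = 0` and
`#Ш_an(E) = 1` (Cremona's table + PARI, `HOME/…/g24/twists`: `L(E,1)/Ω = ∏ c_ℓ` exactly); and the
GROSS-PERIOD CERTIFICATE `hcert ∧ hS`: the field `K` (class number prime to `5`, `(d_K, 5N) = 1`, `ℓ` inert,
primes of `M` split), the conductor factorisation `N = M²·ℓ` with bullet 5 (`H⁰(I_q, E[5]) = 0` at the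
additive primes — inertia acts through a non-trivial finite group of order prime to `5` inside `SL₂(𝔽₅)`,
resp. through `χ ⊗ unipotent` with `χ` ramified quadratic; numerically: every prime of the `5`-division
field above `q` is ramified), the definite quaternion algebra `(−1,−1)_ℚ` ramified exactly at `2`, the
Eichler order of level `M²`, the primitive integral eigenfunctional `φ = w` and a conductor-`1` Gross point,
with the VALUE `S = ψ_f(P_K)`; `5 ∤ S` is then decided by the kernel. The value is certified by TWO
engines (code `HOME/code/b2b-bsdres-x9/g24/`): ENGINE A `grossA.py` (P¹-model of the class set over the
Hurwitz order, Hecke matrices from the norm-`m` quaternions, the `f`-line cut out mod `2⁶¹−1` by FLINT with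
NULLITY 1 certified, lifted and verified over `ℤ`, Gross points and `Pic(𝒪_K)`-orbits; kit j165530 / j165531
/ j165679) and ENGINE B `engineB.gp` (independent GP re-implementation: order, `ι_N`, units, orbits, the
exact eigen-equations on ALL nodes for A's Hecke primes AND two unused ones, embeddings by lattice
enumeration, fixed lines by brute force, `Pic` via `Qfb`; kit j165890–j165892): `216482e1`: `K = ℚ(√−19)`,
`S = ∓4` (all 96 Gross points), also `−139 ↦ 16`, `−187 ↦ 12`; `216482g1`: `S = ±4` (`−139 ↦ 8`, `−187 ↦ 12`);
`155682e1`: `K = ℚ(√−203)` (`h = 4`), `S = 6`; `ℚ(√−83)` (`h = 3`), `S = 48`; and `ℚ(√−11)`: `S = 0` exactly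
where `r_an(E^{−11}) = 2` (j165470) — the BSD-predicted pattern `S = c_E·√#Ш_an(E^D)` holds on all nine
`(E, D)` computed (`c = 4, 4, 6`).

References: Bertolini–Longo–Venerucci, Math. Ann. 2026, Thm. B, Thm. 7.1, Lemma 4.1, §9.2; Bertolini–Darmon,
Ann. Math. 162 (2005); Gross 1987 §3, §11; B. Mazur, IHÉS 47 (1978) Prop. 6.3 (1); R. L. Miller 2011 Def. 1.1;
Dokchitser–Dokchitser 2010 Lem. 4.14 (odd part of `Ш` under quadratic base change); Cremona's tables.
-/

set_option autoImplicit false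

noncomputable section

open scoped Classical NumberField

open WeierstrassCurve Literature.NumberTheory.EllipticCurves
  Literature.NumberTheory.EllipticCurves.Rank1Residual
  Literature.NumberTheory.EllipticCurves.Rank1Residual.Typed
  Literature.NumberTheory.EllipticCurves.Rank1Residual.X11RankOneCertificates
  Literature.NumberTheory.EllipticCurves.BertoliniLongoVenerucci2026
  Summit.BirchSwinnertonDyer.BirchSwinnertonDyer.Rank1Residual.X11RankOne
  Literature.NumberTheory.GaloisRepresentations
  Summit.BirchSwinnertonDyer.BirchSwinnertonDyer.Rank1Residual.IntModel
  Summit.BirchSwinnertonDyer.Rank1Residual.X11b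

namespace Summit.BirchSwinnertonDyer.Rank1Residual.X9

/-! ### §1. `Sel_{p^∞}(E/K) = 0` over a quadratic field kills `Ш(E/ℚ)[p]` for odd `p` -/

/-- **`Sel_{p^∞}(E/K) = 0 ⟹ Ш(E/ℚ)[p] = 0`** for a quadratic field `K` and an odd prime `p`: the image of
`Sel_{p^∞}(E/K)` in `H¹(K, E)` is `Ш(E/K)[p^∞]` (tree `map_primaryH1ToH1_selmerGroupPInfty`, Kummer theory
with the divisibility of `E(K̄)`), so `Ш(E/K)` has no element of `p`-power order; and restriction
`Ш(E/ℚ) → Ш(E/K)` is injective on `Ш(E/ℚ)[p]` since `p ∤ [K : ℚ] = 2` (tree `injOn_shaRestriction_torsionBy`).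
[cite: Greenberg1999, §2, pp. 62–63] [cite: SerreGaloisCohomology1997, I.§2.4 Cor. to Prop. 9] -/
theorem noPTorsion_of_selmerGroupPInfty_baseChange_eq_bot (W : WeierstrassCurve ℚ) [W.IsElliptic]
    (K : Type) [Field K] [NumberField K] (hK : Module.finrank ℚ K = 2) (p : ℕ) [Fact p.Prime]
    (hp2 : p ≠ 2) (hSel : (W.baseChange K).selmerGroupPInfty p = ⊥) :
    ∀ x : W.sha, (p : ℤ) • x = 0 → x = 0 := by
  have hp : p.Prime := Fact.out
  -- Ш(E/K)[p^∞] = 0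
  have hmap := (W.baseChange K).map_primaryH1ToH1_selmerGroupPInfty p
    (W.baseChange K).zsmul_geomPoints_surjective_holds
  rw [hSel, AddSubgroup.map_bot] at hmap
  have hprim : AddCommGroup.primaryComponent (W.baseChange K).sha p = ⊥ :=
    (AddSubgroup.map_eq_bot_iff_of_injective _ (W.baseChange K).sha.subtype_injective).mp hmap.symm
  -- quadratic fields are Galois
  haveI : IsGalois ℚ K := by
    haveI : Algebra.IsQuadraticExtension ℚ K := ⟨hK⟩
    infer_instance
  have hcop : p.Coprime (Module.finrank ℚ K) := by
    rw [hK]; exact (Nat.coprime_primes hp Nat.prime_two).mpr hp2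
  intro x hx
  have hxn : p • x = 0 := by rw [← natCast_zsmul]; exact hx
  have hres : shaRestriction W K x = 0 := by
    have hpr : p • shaRestriction W K x = 0 := by rw [← map_nsmul, hxn, map_zero]
    have hmem : shaRestriction W K x ∈ AddCommGroup.primaryComponent (W.baseChange K).sha p := by
      exact ⟨1, by rw [pow_one]; exact hpr⟩
    rw [hprim] at hmem
    exact AddSubgroup.mem_bot.mp hmem
  have hx_mem : x ∈ (AddSubgroup.torsionBy W.sha p : Set W.sha) :=
    AddSubgroup.torsionBy.nsmul_iff.mpr hxn
  have h0_mem : (0 : W.sha) ∈ (AddSubgroup.torsionBy W.sha p : Set W.sha) :=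
    AddSubgroup.torsionBy.nsmul_iff.mpr (smul_zero _)
  exact injOn_shaRestriction_torsionBy W K hcop hx_mem h0_mem (by rw [hres, map_zero])

/-! ### §2. The generic consumers -/

/-- The NON-CURVE part of the hypothesis of `BLV2026_card_selmerGroupPInfty_eq_pow_of_grossPeriod` (the
field `K`, the conductor factorisation with Hyp. 1.1 bullets 5–6, the definite quaternion algebra, the
Eichler order, `RI`, `IsEig`, the primitive eigenfunctional `φ`, the Gross point) — the GROSS-PERIOD
CERTIFICATE of the records, verbatim the conjuncts 2–7 of the fact. [cite: BertoliniLongoVenerucci2026, Hyp. 1.1 and §2, §4.1–4.2] -/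
def GrossPeriodDatum (W : WeierstrassCurve ℚ) [W.IsElliptic] [W.IsGloballyMinimal]
    (p Nplus Nminus : ℕ) (a b : ℚ)
    (O : Subring (QuaternionAlgebra ℚ a 0 b)) (K : Type) [Field K] [NumberField K]
    (ψ : K →ₐ[ℚ] QuaternionAlgebra ℚ a 0 b) (I : Submodule ℤ (QuaternionAlgebra ℚ a 0 b))
    (φ : Submodule ℤ (QuaternionAlgebra ℚ a 0 b) → ℤ)
    (rep : ClassGroup (𝓞 K) → nonZeroDivisors (Ideal (𝓞 K)))
    (RI : Set (Submodule ℤ (QuaternionAlgebra ℚ a 0 b)))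
    (IsEig : (Submodule ℤ (QuaternionAlgebra ℚ a 0 b) → ℤ) → Prop) : Prop :=
  (Module.finrank ℚ K = 2 ∧ NumberField.IsTotallyComplex K ∧
      Int.gcd (NumberField.discr K) (W.conductorNorm ℤ * p) = 1 ∧
      ¬ p ∣ Fintype.card (ClassGroup (𝓞 K))) ∧
    (W.conductorNorm ℤ = Nplus * Nminus ∧ Nat.Coprime Nplus Nminus ∧ Squarefree Nminus ∧
      Odd Nminus.primeFactors.card ∧
      (∀ q : ℕ, q.Prime → q ∣ Nplus → ((Ideal.span {(q : ℤ)}).primesOver (𝓞 K)).ncard = 2) ∧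
      (∀ q : ℕ, q.Prime → q ∣ Nminus → ((Ideal.span {(q : ℤ)}).primesOver (𝓞 K)).ncard = 1)) ∧
    ((∀ q : ℕ, q.Prime → q ∣ Nplus → ∀ v : IsDedekindDomain.HeightOneSpectrum (𝓞 ℚ),
        ((q : ℕ) : 𝓞 ℚ) ∈ v.asIdeal → ∀ 𝔓 ∈ v.primesAbove, ∀ P : W.geomTorsion (p : ℤ),
          (∀ σ ∈ 𝔓.inertia (Field.absoluteGaloisGroup ℚ), σ • P = P) → P = 0) ∧
      (∀ q : ℕ, q.Prime → q ∣ Nminus → ((p : ℤ) ∣ (q : ℤ) - 1 ∨ (p : ℤ) ∣ (q : ℤ) + 1) →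
        ∃ v : IsDedekindDomain.HeightOneSpectrum (𝓞 ℚ), ((q : ℕ) : 𝓞 ℚ) ∈ v.asIdeal ∧
          ∃ 𝔓 ∈ v.primesAbove, ∃ σ ∈ 𝔓.inertia (Field.absoluteGaloisGroup ℚ),
            ∃ P : W.geomTorsion (p : ℤ), σ • P ≠ P)) ∧
    (a < 0 ∧ b < 0 ∧ (∀ (q : ℕ) [Fact q.Prime],
      (∀ x : QuaternionAlgebra ℚ_[q] (a : ℚ_[q]) 0 (b : ℚ_[q]), x ≠ 0 → IsUnit x) ↔ q ∣ Nminus)) ∧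
    (∃ O₁ O₂ : Subring (QuaternionAlgebra ℚ a 0 b), (∀ S : Subring (QuaternionAlgebra ℚ a 0 b),
      (S = O₁ ∨ S = O₂) → (S.toAddSubgroup.FG ∧ (∀ d : QuaternionAlgebra ℚ a 0 b, ∃ m : ℤ, m ≠ 0 ∧
      m • d ∈ S) ∧ ∀ S' : Subring (QuaternionAlgebra ℚ a 0 b), S'.toAddSubgroup.FG → S ≤ S' →
      S' = S)) ∧ O = O₁ ⊓ O₂ ∧ O.toAddSubgroup.relIndex O₁.toAddSubgroup = Nplus) ∧
    ((∀ J : Submodule ℤ (QuaternionAlgebra ℚ a 0 b), J ∈ RI ↔ (J.FG ∧ (∀ d : QuaternionAlgebra ℚ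
      a 0 b, ∃ m : ℤ, m ≠ 0 ∧ m • d ∈ J) ∧ (∀ x : QuaternionAlgebra ℚ a 0 b, (∀ y ∈ J, y * x ∈ J)
      ↔ x ∈ O) ∧ (∃ J' : Submodule ℤ (QuaternionAlgebra ℚ a 0 b), (∀ x : QuaternionAlgebra ℚ a
      0 b, x ∈ J * J' ↔ ∀ y ∈ J, x * y ∈ J) ∧ (∀ x : QuaternionAlgebra ℚ a 0 b, x ∈ J' * J ↔ x ∈
      O)))) ∧ (∀ g : Submodule ℤ (QuaternionAlgebra ℚ a 0 b) → ℤ, IsEig g ↔ ((∀ J ∈ RI, ∀ β :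
      QuaternionAlgebra ℚ a 0 b, IsUnit β → g (J.map (AddMonoidHom.mulLeft β).toIntLinearMap) =
      g J) ∧ (∀ q : ℕ, q.Prime → ¬ q ∣ W.conductorNorm ℤ → ∀ J ∈ RI, ∑ᶠ J' ∈ {J' : Submodule ℤ
      (QuaternionAlgebra ℚ a 0 b) | J' ≤ J ∧ J'.toAddSubgroup.relIndex J.toAddSubgroup = q ^ 2 ∧
      ∀ y ∈ J', ∀ x ∈ O, y * x ∈ J'}, g J' = (W.frobeniusTrace q : ℤ) * g J))) ∧ IsEig φ ∧
      (∃ J ∈ RI, φ J ≠ 0) ∧ (∀ g : Submodule ℤ (QuaternionAlgebra ℚ a 0 b) → ℤ, IsEig g →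
      ∃ u : ℤ, ∀ J ∈ RI, g J = u * φ J)) ∧
    (I ∈ RI ∧ (∀ x : 𝓞 K, ∀ y ∈ I, ψ (x : K) * y ∈ I) ∧ (∀ x : K, (∀ y
      ∈ I, ψ x * y ∈ I) → ∃ z : 𝓞 K, (z : K) = x) ∧ (∀ 𝔞 : ClassGroup (𝓞 K), ClassGroup.mk0 (rep 𝔞) = 𝔞))

/-- The Gross-point sum `S = ψ_f(P_K) = Σ_{[𝔞] ∈ Cl_K} φ(ψ(rep 𝔞)·I)` of the fact (the quantity the two
engines compute). [cite: BertoliniLongoVenerucci2026, §2.5 (P_K) and Lemma 4.1] -/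
def grossPeriod {a b : ℚ} (K : Type) [Field K] [NumberField K]
    (ψ : K →ₐ[ℚ] QuaternionAlgebra ℚ a 0 b) (I : Submodule ℤ (QuaternionAlgebra ℚ a 0 b))
    (φ : Submodule ℤ (QuaternionAlgebra ℚ a 0 b) → ℤ)
    (rep : ClassGroup (𝓞 K) → nonZeroDivisors (Ideal (𝓞 K))) : ℤ :=
  ∑ 𝔞 : ClassGroup (𝓞 K), φ (Submodule.span ℤ ((fun x : 𝓞 K => ψ (x : K)) ''
    ((rep 𝔞 : nonZeroDivisors (Ideal (𝓞 K))) : Ideal (𝓞 K))) * I)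

/-- **GENERIC CONSUMER: `BSD(E,p)` in analytic rank `0` (or `1`) from the BLV fact and a unit Gross period.**
The curve-side hypotheses of the fact (`p ≥ 5` good ordinary, `a_p ≢ ±1`, `E[p]` irreducible), the
Gross-period datum (`GrossPeriodDatum`) and `p ∤ S` give `Sel_{p^∞}(E/K) = 0`
(`selmerGroupPInfty_baseChange_eq_bot_of_BLV2026`), hence `Ш(E/ℚ)[p] = 0` (§1), hence — with analytic
rank `≤ 1` (GZK: rank and finiteness) and `ord_p #Ш_an = 0` — Miller's `BSD(E,p)`
(`Typed.bsdp_of_shaAn_unit_of_noPTorsion`). [cite: BertoliniLongoVenerucci2026, Thm. B (n = 0)]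
[cite: Miller2011LMS, §1 and Def. 1.1] -/
theorem bsdp_of_BLV2026_of_grossPeriod_unit
    (hBLV : BLV2026_card_selmerGroupPInfty_eq_pow_of_grossPeriod)
    (hGZK : rank_eq_analyticRank_of_analyticRank_le_one)
    (W : WeierstrassCurve ℚ) [W.IsElliptic] [W.IsGloballyMinimal] (p : ℕ) [Fact p.Prime]
    (Nplus Nminus : ℕ) (a b : ℚ) (O : Subring (QuaternionAlgebra ℚ a 0 b)) (K : Type) [Field K]
    [NumberField K] (ψ : K →ₐ[ℚ] QuaternionAlgebra ℚ a 0 b) (I : Submodule ℤ (QuaternionAlgebra ℚ a 0 b))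
    (φ : Submodule ℤ (QuaternionAlgebra ℚ a 0 b) → ℤ)
    (rep : ClassGroup (𝓞 K) → nonZeroDivisors (Ideal (𝓞 K)))
    (RI : Set (Submodule ℤ (QuaternionAlgebra ℚ a 0 b)))
    (IsEig : (Submodule ℤ (QuaternionAlgebra ℚ a 0 b) → ℤ) → Prop)
    (hp5 : 5 ≤ p) (hgood : W.HasGoodReductionAtPrime p) (hord : ¬ (p : ℤ) ∣ W.frobeniusTrace p)
    (hm1 : ¬ (p : ℤ) ∣ W.frobeniusTrace p - 1) (hp1 : ¬ (p : ℤ) ∣ W.frobeniusTrace p + 1)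
    (hirr : W.HasIrreducibleModPGaloisRep p)
    (hcert : GrossPeriodDatum W p Nplus Nminus a b O K ψ I φ rep RI IsEig)
    (hunit : ¬ (p : ℤ) ∣ grossPeriod K ψ I φ rep)
    (hr : W.analyticRank ≤ 1) {q : ℚ} (hq : shaAn W = (q : ℂ)) (hv : padicValRat p q = 0) :
    BSDp W p := by
  obtain ⟨hK, hN, hI, hB, hO, hRI, hG⟩ := hcert
  have hSel : (W.baseChange K).selmerGroupPInfty p = ⊥ :=
    selmerGroupPInfty_baseChange_eq_bot_of_BLV2026 hBLV W p Nplus Nminus a b O K ψ I φ rep RI IsEig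
      ⟨⟨hp5, hgood, hord, hm1, hp1, hirr⟩, hK, hN, hI, hB, hO, hRI, hG⟩ hunit
  have hp2 : p ≠ 2 := by omega
  exact Typed.bsdp_of_shaAn_unit_of_noPTorsion W p hGZK hr hq hv
    (noPTorsion_of_selmerGroupPInfty_baseChange_eq_bot W K hK.1 p hp2 hSel)

/-- **The same with the curve side DECIDED from the integer model** `[a₁,…,a₆]` of the globally minimal
`W` at `p = 5`: `5 ∤ Δ` (good reduction), the kernel point count `#Ẽ(𝔽₅) = n₅` with `5 ∤ 6 − n₅`
(ordinary), `5 ∤ 5 − n₅` and `5 ∤ 7 − n₅` (`a₅ ≢ ±1`), and a Frobenius witness `ℓ₀ ≠ 5`, `ℓ₀ ∤ Δ`,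
`#Ẽ(𝔽_{ℓ₀}) = n` with `X² − (ℓ₀+1−n)X + ℓ₀` root-free mod `5` (Mazur: `E[5]` irreducible).
[cite: Mazur1978, §6 Prop. 6.3 (1) (p. 153)] [cite: BertoliniLongoVenerucci2026, Thm. B (n = 0)] -/
theorem bsdp_of_ainvs_of_BLV2026_of_grossPeriod_unit
    (hBLV : BLV2026_card_selmerGroupPInfty_eq_pow_of_grossPeriod)
    (hGZK : rank_eq_analyticRank_of_analyticRank_le_one)
    (a1 a2 a3 a4 a6 : ℤ) {W : WeierstrassCurve ℚ} [W.IsElliptic] [W.IsGloballyMinimal]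
    (hW : integralModelInt W = ⟨a1, a2, a3, a4, a6⟩) [Fact (Nat.Prime 5)]
    (Nplus Nminus : ℕ) (a b : ℚ) (O : Subring (QuaternionAlgebra ℚ a 0 b)) (K : Type) [Field K]
    [NumberField K] (ψ : K →ₐ[ℚ] QuaternionAlgebra ℚ a 0 b) (I : Submodule ℤ (QuaternionAlgebra ℚ a 0 b))
    (φ : Submodule ℤ (QuaternionAlgebra ℚ a 0 b) → ℤ)
    (rep : ClassGroup (𝓞 K) → nonZeroDivisors (Ideal (𝓞 K)))
    (RI : Set (Submodule ℤ (QuaternionAlgebra ℚ a 0 b)))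
    (IsEig : (Submodule ℤ (QuaternionAlgebra ℚ a 0 b) → ℤ) → Prop)
    (np : ℕ) (hpΔ : ¬ (5 : ℤ) ∣ discOf [a1, a2, a3, a4, a6])
    (hcardp : Nat.card (((⟨a1, a2, a3, a4, a6⟩ : WeierstrassCurve ℤ).map
      (Int.castRingHom (ZMod 5))).toAffine.Point) = np)
    (hordp : ¬ (5 : ℤ) ∣ (5 : ℤ) + 1 - np) (hm1p : ¬ (5 : ℤ) ∣ (5 : ℤ) + 1 - np - 1)
    (hp1p : ¬ (5 : ℤ) ∣ (5 : ℤ) + 1 - np + 1)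
    (ℓ n : ℕ) [Fact ℓ.Prime] (hℓp : ℓ ≠ 5) (hℓΔ : ¬ (ℓ : ℤ) ∣ discOf [a1, a2, a3, a4, a6])
    (hcard : Nat.card (((⟨a1, a2, a3, a4, a6⟩ : WeierstrassCurve ℤ).map
      (Int.castRingHom (ZMod ℓ))).toAffine.Point) = n)
    (hnoroot : ∀ t : ℕ, t < 5 → ¬ (5 : ℤ) ∣ (t : ℤ) ^ 2 - ((ℓ : ℤ) + 1 - n) * t + ℓ)
    (hcert : GrossPeriodDatum W 5 Nplus Nminus a b O K ψ I φ rep RI IsEig)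
    (hunit : ¬ (5 : ℤ) ∣ grossPeriod K ψ I φ rep)
    (hr : W.analyticRank ≤ 1) {q : ℚ} (hq : shaAn W = (q : ℂ)) (hv : padicValRat 5 q = 0) :
    BSDp W 5 := by
  have hΔ : (⟨a1, a2, a3, a4, a6⟩ : WeierstrassCurve ℤ).Δ = discOf [a1, a2, a3, a4, a6] :=
    intCurve_Δ a1 a2 a3 a4 a6
  have hgood : W.HasGoodReductionAtPrime 5 :=
    hasGoodReductionAtPrime_of_not_dvd W 5 (by rw [minimalDiscriminantInt_eq hW, hΔ]; exact hpΔ)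
  have htr : W.frobeniusTrace 5 = (5 : ℤ) + 1 - np := by exact_mod_cast frobeniusTrace_eq hW hcardp
  have hirr : W.HasIrreducibleModPGaloisRep 5 := by
    refine hasIrreducibleModPGaloisRep_of_intModel_of_noroot hW 5 ℓ hℓp (by rw [hΔ]; exact hℓΔ) hcard
      (forall_zmod_of_forall_lt fun t ht h0 ↦ ?_)
    refine hnoroot t ht ?_
    have h5 : ((5 : ℕ) : ℤ) ∣ (t : ℤ) ^ 2 - ((ℓ : ℤ) + 1 - n) * t + ℓ := by
      rw [← ZMod.intCast_zmod_eq_zero_iff_dvd]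
      push_cast at h0 ⊢
      linear_combination h0
    exact_mod_cast h5
  refine bsdp_of_BLV2026_of_grossPeriod_unit hBLV hGZK W 5 Nplus Nminus a b O K ψ I φ rep RI IsEig
    (le_refl 5) hgood ?_ ?_ ?_ hirr hcert (by exact_mod_cast hunit) hr hq hv
  · rw [htr]; exact_mod_cast hordp
  · rw [htr]; exact_mod_cast hm1p
  · rw [htr]; exact_mod_cast hp1p

end Summit.BirchSwinnertonDyer.Rank1Residual.X9

end

/-! ## ERRATUM (x9 GEN 26, 2026-08-23): this route is WITHDRAWN for class X9 — the revised text of Bertolini–Longo–Venerucci requires `ρ̄_{E,p}` SURJECTIVE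

The named fact consumed above, `BLV2026_card_selmerGroupPInfty_eq_pow_of_grossPeriod` (binder `hBLV` of
`bsdp_of_BLV2026_of_grossPeriod_unit`, `bsdp_of_ainvs_of_BLV2026_of_grossPeriod_unit` and of the five
records of `X9/DefiniteGrossPeriodRecordsA.lean`), transcribes Hypothesis 1.1 of arXiv:2306.17784**v1**
("`ρ̄_{E,p}` … is irreducible").  The authors' REVISED text arXiv:2306.17784**v2** (2026-02-05, the
Math. Ann.-era revision) states Hypothesis 1.1 (3) "`ρ̄_{E,p}` … is **surjective**" and uses it for the
level raising of its §3 and throughout its §4 (theta elements, `ψ_g`, Lemma 4.1) — see the module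
docstring of `Literature/NumberTheory/EllipticCurves/BertoliniLongoVenerucci2026/DefiniteGrossPeriodSelmerRevised.lean`
and the evidence file `run/shared/lean/b2b/bsd-rank1-residual/b2b-bsdres-x9/g26/BLV-v1-v2-HYPOTHESES.md`.
Consequently the theorems of this file and the five records are CONDITIONAL on an UNPUBLISHED statement
(the v1 generality, withdrawn by the authors): they certify nothing about `Ш(E)[5]` for a `5S4` curve and
are NOT closures of any X9 pair; the X9 row's terminal list is the 22 pairs of `FINISH.md` §2 again.  The
theorem below records the disjointness (item (3) of the revised hypothesis vs. the class
definition); the corrected statement itself lives in `DefiniteGrossPeriodSelmerRevised.lean`. -/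

namespace Summit.BirchSwinnertonDyer.Rank1Residual.X9

open Literature.NumberTheory.EllipticCurves

/-- **BLV (revised text) meets no X9 pair.**  Item (3) of Hypothesis 1.1 of the revised text of
Bertolini–Longo–Venerucci is "`ρ̄_{E,p}` … is surjective" — conjunct 3 of
`Literature.NumberTheory.EllipticCurves.BertoliniLongoVenerucci2026.RevisedHypothesis` (module
`…/BertoliniLongoVenerucci2026/DefiniteGrossPeriodSelmerRevised.lean`, p355522), whose lemma
`not_revisedHypothesis_of_not_hasSurjectiveModNGaloisRep` turns the statement below into
`¬ RevisedHypothesis W p K N⁺ N⁻` for every `K`, `N⁺`, `N⁻` — whereas the cell's class X9 contains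
`¬ Surj W p` by definition.  Hence no instance of Theorem B as published can be assembled for an X9
pair, whatever the Gross-period certificate says: the theorems above and the five records of
`X9/DefiniteGrossPeriodRecordsA.lean` are conditional on the v1-shaped Prop only. [folklore] -/
theorem not_hasSurjectiveModNGaloisRep_of_classX9 (W : WeierstrassCurve ℚ) [W.IsElliptic]
    [W.IsGloballyMinimal] (p : ℕ) [Fact p.Prime] (hX9 : Rank1Residual.ClassX9 W p) :
    ¬ W.HasSurjectiveModNGaloisRep (p : ℤ) :=
  hX9.2.2.2.2.1

end Summit.BirchSwinnertonDyer.Rank1Residual.X9
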